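import Summits.BirchSwinnertonDyer.Rank1Residual.WAll.TargetCMTwoRamifiedSMinus
import HarnessLib
import HarnessLib.Audit.Tags

/-!
# Rung W-ALL of ladder BSD (D-0120) — the ramified slice of row 12₂: THE THETA-DESCENT FAMILIES OF CELL
# `bsd-monsky` (prover-B: 𝒮⁻-towers / stars and the five three-prime shapes 557 / 377 / 355 / 157 / 135) CARVED OUT OF THE RESIDUAL OF THE p1 ROAD, BY NAME (cell `bsd-print-cf2`, D-0131 (2) PRINT
# TIER, seat p1; crux stmt-BirchSwinnertonDyer-20509 `RamifiedOffTYZOfFacts` of route `PrintCf2`)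

HONEST FRAMING (cell `bsd-print-cf2`, run/shared/lean/pub/bsd-print-cf2/; partition leaf «CornerF @ `p = 2`» =
`Summit.BirchSwinnertonDyer.WAllCornerFTwo`, OPEN AS A CLASS): STATEMENTS AND BOOKKEEPING ONLY — nothing asserted,
nothing booked, no named fact introduced, no published theorem restated. After the `𝒮⁻` carve-out
(`WAll/TargetCMTwoRamifiedSMinus.lean`, p544597; closed INSIDE `𝔅_ram`) the five-way residual
`WAllCornerFTwoRamifiedOffTYZOffSMinus` still contains explicit infinite EVEN families on which the tree PROVES
`ord_{s=1} L(E_n, s) = 1 ∧ rank 1 ∧ Ш(E_n)[2^∞] = 0 ∧ BSD(E_n, 2)` — the THETA-DESCENT families of cell `bsd-monsky`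
(prover-B, namespace `P2.ThetaDescent`): the 𝒮⁻-TOWERS / stars `n = 2·q·p₁⋯p_m` (`rankOne_sha_bsdp_two_tower_of_cmPointGaloisData`,
file `P2/CongruentNumberThetaStarTowersBSD.lean`; `m = 1` with the mark is `𝒮⁻` itself, `m ≥ 2` the towers `1830, 2030,
199470, …, 417966269710`) and the five three-prime shapes of Monsky's conjecture C-P2-2 at `k = 3` — `557` (`2030, 8990, …`),
`377` (`966, 4774, …`), `355` (`1830, 2262, …`), `157` (`2870, 7910, …`), `135` (`1230, 2190, …`) (`…_557_family`,
`…_377_family`, `…_355_family`, `…_157_family`, `…_135_family`; files `P2/CongruentNumberThetaThreePrimes{,B,C,D,E}Family.lean`) —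
MODULO Gross–Zagier–Kolyvagin (`hGZK`, conjunct 1 of `𝔅_ram`), Heath-Brown 1994's even Selmer count (conjunct 10 of `𝔅_ram`,
moreover a THEOREM of the tree `…_even_holds`), and TWO FACTS OUTSIDE `𝔅_ram`: Tian–Yuan–Zhang 2017 Thm 1.1 AS PRINTED
(`TianYuanZhang2017.thm11_parity_of_scriptL`, verbatim) and the §3.1–3.2 CM-point display
`TianYuanZhang2017.tyz_cmPointGaloisData` (∃-display implying `tyz_genusPointData`; LITERAL-by-name in the referee's currency,
like aside 20471). So this slice is an ATTACKED SUB-SLICE of the residual with a by-name closer BEYOND the bundle — the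
status of the U⁺-road leaf (`stub_offTYZ_uPlusLeaf` / aside 20471; K7t doctrine: the planner files an `…OfFactsPlus` aside,
TURNKEY in the closer file). This file names it: membership predicate `CongruentThetaFamily` (§1, six disjuncts, each
VERBATIM the hypotheses of the named theorem), leaf `WAllCornerFTwoRamifiedTheta`, the residuals with the theta families
carved out as well — `WAllCornerFTwoRamifiedOffTYZProvedOffSMinusOffTheta` (flag-free road) and the six-way
`WAllCornerFTwoRamifiedOffTYZOffSMinusOffTheta` (§2) — membership facts (square-free EVEN parameter ⇒ disjoint from the
proved TYZ families, §3), and the glue (§4): `wAllCornerFTwoRamifiedOffTYZProved_iff_sMinus_theta_off` (EXACT),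
`wAllCornerFTwoRamifiedOffTYZOffSMinus_iff_onTheta_off` (EXACT), the five-leaf composition
`wAllCornerFTwoRamifiedOffTYZProved_of_uPlus_of_atlasFJ_of_sMinus_of_theta_of_off` for the reshaped skeleton of crux
20509, and the cuts of the ramified slice / row 12₂. The closer lands in
`Summits/BirchSwinnertonDyer/BirchSwinnertonDyer/Theorems/PrintCf2RamifiedOffTYZThetaLeaf.lean` (seat p1).
(The ρ-six cut of `WAll/TargetCMTwoRamifiedRhoSix.lean`, p547613, is empirically thin and is NOT nested here.)

WHY (seat p1, strategy «Tian–Yuan–Zhang induction BY NAME: Heegner points + genus theory + Gross–Zagier/Waldspurger ⇒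
2-part of BSD for `E_n` with controlled prime factorisations … typed as class theorems on explicit infinite families»):
these are explicit infinite families with controlled prime factorisations on which BSD(E,2) follows from TYZ's genus-point /
CM-point framework (Thm 1.1 for the auxiliary twists, Thm 3.5/3.6, the Galois action on `z_n`) plus a 2-descent count;
BEYOND PRINT — Monsky 1990 p. 67 Remark (3) conjectures the two-prime case only; no printed statement covers the towers
or the `k = 3` shapes.

References: `WAll/TargetCMTwoRamifiedFamilies.lean` (p533515), `WAll/TargetCMTwoRamifiedOffTYZProved.lean` (p536500),
`WAll/TargetCMTwoRamifiedSMinus.lean` (p544597), `P2/CongruentNumberThetaStarTowersBSD.lean`,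
`P2/CongruentNumberThetaStarTowers.lean`, `P2/CongruentNumberThetaThreePrimes{,B,C,D,E}Family.lean`, `Literature/…/TianYuanZhang2017/CMPointGaloisDisplays.lean`
(`tyz_cmPointGaloisData`), `…/GenusPeriodsParity.lean` (`thm11_parity_of_scriptL`).
[cite: Monsky1990MockHeegner, p. 67 Remark (3)] [cite: TianYuanZhang2017, Thm. 1.1, §1 (1.1), Thm. 3.5, Thm. 3.6]
[cite: HeathBrown1994SelmerCongruentII, Appendix (Monsky), typescript p. 41 L20–L36] [cite: Miller2011LMS, §1 and Def. 1.1].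
-/

noncomputable section

open scoped Classical

open WeierstrassCurve Literature.NumberTheory.EllipticCurves
  Literature.NumberTheory.EllipticCurves.Rank1Residual
open Summit.BirchSwinnertonDyer.Rank1Residual

set_option autoImplicit false

namespace Summit.BirchSwinnertonDyer

/-! ### §1. Membership predicate: the theta-descent families (towers / stars, 557, 377, 355, 157, 135) -/

/-- **The theta-descent families of cell `bsd-monsky` (prover-B)** as a class at `2` — `W` is a `ℚ`-model of `E_n` for
`n` in ONE of the six even shapes on which the tree proves `ord = 1 ∧ rank 1 ∧ Ш[2^∞] = 0 ∧ BSD(E_n, 2)` modulo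
{`tyz_cmPointGaloisData`, TYZ Thm 1.1, GZK, Heath-Brown 1994 even (proved)}, each disjunct VERBATIM the hypotheses of
the named `P2.ThetaDescent` theorem: (T) the 𝒮⁻-TOWERS / stars `n = 2·q·p₁⋯p_m`, `q ≡ 3 (4)`, `pᵢ ≡ 5 (8)` distinct,
mutual quadratic residues, at most one mark `(pᵢ/q) = −1` and at least one unless `q ≡ 3 (8)`
(`rankOne_sha_bsdp_two_tower_of_cmPointGaloisData`); (557) `n = 2p₁p₂p₃`, `p₁ ≡ p₂ ≡ 5`, `p₃ ≡ 7 (8)`, `p₁ ≠ p₂`,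
`(p₁p₂/p₃) = −1` (`…_557_family`); (377) `p₁ ≡ 3`, `p₂ ≡ p₃ ≡ 7 (8)`, `p₂ ≠ p₃`, `(p₂p₃/p₁) = −1`, `(p₃/p₂) = (p₂/p₁)`
(`…_377_family`); (355) `p₁ ≡ 3`, `p₂ ≡ p₃ ≡ 5 (8)`, `p₂ ≠ p₃`, at least two of `(p₂/p₁), (p₃/p₁), (p₃/p₂)` equal `+1`
(`…_355_family`); (157) `p₁ ≡ 1`, `p₂ ≡ 5`, `p₃ ≡ 7 (8)`, at least two of the three symbols equal `−1` (`…_157_family`);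
(135) `p₁ ≡ 1`, `p₂ ≡ 3`, `p₃ ≡ 5 (8)`, `(p₂/p₁) ≠ (p₃/p₁)` (`…_135_family`). A predicate; nothing asserted.
[cite: Monsky1990MockHeegner, p. 67 Remark (3)] [cite: TianYuanZhang2017, Thm. 1.1, Thm. 3.5, Thm. 3.6] -/
def CongruentThetaFamily : P2.ClassAtTwo := fun W _ _ =>
  (∃ (m q : ℕ) (p : Fin m → ℕ), q.Prime ∧ q % 4 = 3 ∧ (∀ i, (p i).Prime) ∧ (∀ i, p i % 8 = 5) ∧
    Function.Injective p ∧ (∀ i j, i ≠ j → jacobiSym (p j) (p i) = 1) ∧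
    (∀ i j, jacobiSym (p i) q = -1 → jacobiSym (p j) q = -1 → i = j) ∧
    (q % 8 = 3 ∨ ∃ a, jacobiSym (p a) q = -1) ∧
    ∃ C : VariableChange ℚ, C • congruentNumberCurve (2 * (q * ∏ i, p i)) = W) ∨
  (∃ p₁ p₂ p₃ : ℕ, p₁.Prime ∧ p₂.Prime ∧ p₃.Prime ∧ p₁ % 8 = 5 ∧ p₂ % 8 = 5 ∧ p₃ % 8 = 7 ∧ p₁ ≠ p₂ ∧
    jacobiSym ((p₁ : ℤ) * p₂) p₃ = -1 ∧
    ∃ C : VariableChange ℚ, C • congruentNumberCurve (2 * (p₁ * p₂ * p₃)) = W) ∨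
  (∃ p₁ p₂ p₃ : ℕ, p₁.Prime ∧ p₂.Prime ∧ p₃.Prime ∧ p₁ % 8 = 3 ∧ p₂ % 8 = 7 ∧ p₃ % 8 = 7 ∧ p₂ ≠ p₃ ∧
    jacobiSym ((p₂ : ℤ) * p₃) p₁ = -1 ∧ jacobiSym (p₃ : ℤ) p₂ = jacobiSym (p₂ : ℤ) p₁ ∧
    ∃ C : VariableChange ℚ, C • congruentNumberCurve (2 * (p₁ * p₂ * p₃)) = W) ∨
  (∃ p₁ p₂ p₃ : ℕ, p₁.Prime ∧ p₂.Prime ∧ p₃.Prime ∧ p₁ % 8 = 3 ∧ p₂ % 8 = 5 ∧ p₃ % 8 = 5 ∧ p₂ ≠ p₃ ∧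
    ((jacobiSym (p₂ : ℤ) p₁ = 1 ∧ jacobiSym (p₃ : ℤ) p₁ = 1) ∨ (jacobiSym (p₂ : ℤ) p₁ = 1 ∧ jacobiSym (p₃ : ℤ) p₂ = 1) ∨
      (jacobiSym (p₃ : ℤ) p₁ = 1 ∧ jacobiSym (p₃ : ℤ) p₂ = 1)) ∧
    ∃ C : VariableChange ℚ, C • congruentNumberCurve (2 * (p₁ * p₂ * p₃)) = W) ∨
  (∃ p₁ p₂ p₃ : ℕ, p₁.Prime ∧ p₂.Prime ∧ p₃.Prime ∧ p₁ % 8 = 1 ∧ p₂ % 8 = 5 ∧ p₃ % 8 = 7 ∧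
    ((jacobiSym (p₂ : ℤ) p₁ = -1 ∧ jacobiSym (p₃ : ℤ) p₁ = -1) ∨ (jacobiSym (p₂ : ℤ) p₁ = -1 ∧ jacobiSym (p₃ : ℤ) p₂ = -1) ∨
      (jacobiSym (p₃ : ℤ) p₁ = -1 ∧ jacobiSym (p₃ : ℤ) p₂ = -1)) ∧
    ∃ C : VariableChange ℚ, C • congruentNumberCurve (2 * (p₁ * p₂ * p₃)) = W) ∨
  (∃ p₁ p₂ p₃ : ℕ, p₁.Prime ∧ p₂.Prime ∧ p₃.Prime ∧ p₁ % 8 = 1 ∧ p₂ % 8 = 3 ∧ p₃ % 8 = 5 ∧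
    jacobiSym (p₂ : ℤ) p₁ ≠ jacobiSym (p₃ : ℤ) p₁ ∧
    ∃ C : VariableChange ℚ, C • congruentNumberCurve (2 * (p₁ * p₂ * p₃)) = W)

/-! ### §2. Leaves: the theta slice and the residuals off it -/

/-- **Ramified slice ON THE THETA-DESCENT FAMILIES** (closed BEYOND `𝔅_ram` by
`PrintCf2.wAllCornerFTwoRamifiedTheta_of_facts (hCM) (h11) (hGZK)`: TYZ §3.1–3.2 CM-point display, TYZ Thm 1.1 as printed, GZK; Heath-Brown 1994's even count being a
tree theorem): CM, `ord_{s=1} L(E,s) = 1`, `2 ∣ d_K`, `W ∈ CongruentThetaFamily` ⇒ `BSD(E,2)`. [folklore] -/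
@[conjecture] def WAllCornerFTwoRamifiedTheta : Prop :=
  ∀ (W : WeierstrassCurve ℚ) [W.IsElliptic] [W.IsGloballyMinimal],
    W.HasCM → W.analyticRank = 1 → CMRamified W 2 → CongruentThetaFamily W → BSDp W 2

/-- **Flag-free residual OFF the proved TYZ families, OFF `𝒮⁻` AND OFF the theta families (OPEN)** — the residual of
the FLAG-FREE p1 road after the `𝒮⁻` carve-out with the theta families (attacked beyond the bundle) carved out as well.
No theorem in print. [folklore] -/
@[conjecture] def WAllCornerFTwoRamifiedOffTYZProvedOffSMinusOffTheta : Prop :=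
  ∀ (W : WeierstrassCurve ℚ) [W.IsElliptic] [W.IsGloballyMinimal],
    W.HasCM → W.analyticRank = 1 → CMRamified W 2 → ¬ CongruentTYZProvedFamily W →
      ¬ CongruentMonskySMinusFamily W → ¬ CongruentThetaFamily W → BSDp W 2

/-- **Six-way residual: OFF the three TYZ family predicates, OFF `𝒮⁻` AND OFF the theta families (OPEN)** — the
five-way residual `WAllCornerFTwoRamifiedOffTYZOffSMinus` (p544597) with the theta-descent families carved out. Contains: the congruent-number
curves `E_m` of analytic rank one with `s(m) ≥ 3` (`Ш(E_m)[2] ≠ 0`) or with even genus sums outside every theta-descent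
shape, the U⁺-only members not reached by any display, every quartic twist `y² = x³ + Ax` (`±A ∉ ℤ²`), every
`j = 287496` / `j = 8000` curve. No theorem in print. [folklore] -/
@[conjecture] def WAllCornerFTwoRamifiedOffTYZOffSMinusOffTheta : Prop :=
  ∀ (W : WeierstrassCurve ℚ) [W.IsElliptic] [W.IsGloballyMinimal],
    W.HasCM → W.analyticRank = 1 → CMRamified W 2 →
      ¬ CongruentTYZProvedFamily W → ¬ CongruentTYZUPlusFamily W → ¬ CongruentTYZAtlasFJFamily W →
      ¬ CongruentMonskySMinusFamily W → ¬ CongruentThetaFamily W → BSDp W 2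

/-! ### §3. Membership facts: the theta families lie in the ramified slice and are disjoint from the proved TYZ families -/

/-- The parameter `2·q·p₁⋯p_m` of a tower member is square-free (`2`, `q ≡ 3 (4)`, `pᵢ ≡ 5 (8)` distinct primes).
[folklore] -/
theorem squarefree_of_thetaTower {m q : ℕ} {p : Fin m → ℕ} (hq : q.Prime) (hq4 : q % 4 = 3)
    (hp : ∀ i, (p i).Prime) (hp5 : ∀ i, p i % 8 = 5) (hinj : Function.Injective p) :
    Squarefree (2 * (q * ∏ i, p i)) := by
  have cop : ∀ {a b : ℕ}, a.Prime → b.Prime → a ≠ b → a.Coprime b :=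
    fun ha hb hab => (Nat.coprime_primes ha hb).mpr hab
  have hP : Squarefree (∏ i, p i) := by
    have h := HeathBrown1994.squarefree_prod_of_injective
      (fun i : Fin (m + 1) => (Fin.cons q p : Fin (m + 1) → ℕ) i) ?_ ?_
    · rw [Fin.prod_univ_succ] at h
      simp only [Fin.cons_zero, Fin.cons_succ] at h
      exact (Nat.squarefree_mul_iff.mp h).2.2
    · intro i; exact Fin.cases (by simpa using hq) (fun j => by simpa using hp j) i
    · intro i j hij
      refine Fin.cases (fun hij => ?_) (fun i' hij => ?_) i hij <;>
        refine Fin.cases (fun hij => ?_) (fun j' hij => ?_) j hij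
      · rfl
      · simp only [Fin.cons_zero, Fin.cons_succ] at hij
        have := hp5 j'; omega
      · simp only [Fin.cons_zero, Fin.cons_succ] at hij
        have := hp5 i'; omega
      · simp only [Fin.cons_succ] at hij
        rw [hinj hij]
  have hqP : q.Coprime (∏ i, p i) := by
    refine Nat.Coprime.prod_right fun i _ => cop hq (hp i) fun h => ?_
    have := hp5 i; omega
  have h2 : (2 : ℕ).Coprime (q * ∏ i, p i) := by
    refine Nat.Coprime.mul_right (cop Nat.prime_two hq (by omega)) (Nat.Coprime.prod_right fun i _ => ?_)
    exact cop Nat.prime_two (hp i) (by have := hp5 i; omega)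
  exact Nat.squarefree_mul_iff.mpr ⟨h2, Nat.prime_two.squarefree,
    Nat.squarefree_mul_iff.mpr ⟨hqP, hq.squarefree, hP⟩⟩

/-- `2·p₁p₂p₃` is square-free for three distinct odd primes. [folklore] -/
theorem squarefree_two_mul_three_primes {p₁ p₂ p₃ : ℕ} (hp₁ : p₁.Prime) (hp₂ : p₂.Prime) (hp₃ : p₃.Prime)
    (ho₁ : p₁ % 2 = 1) (ho₂ : p₂ % 2 = 1) (ho₃ : p₃ % 2 = 1) (h12 : p₁ ≠ p₂) (h13 : p₁ ≠ p₃) (h23 : p₂ ≠ p₃) :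
    Squarefree (2 * (p₁ * p₂ * p₃)) := by
  have cop : ∀ {a b : ℕ}, a.Prime → b.Prime → a ≠ b → a.Coprime b :=
    fun ha hb hab => (Nat.coprime_primes ha hb).mpr hab
  have h2 : (2 : ℕ).Coprime (p₁ * p₂ * p₃) :=
    Nat.Coprime.mul_right (Nat.Coprime.mul_right (cop Nat.prime_two hp₁ (by omega)) (cop Nat.prime_two hp₂ (by omega)))
      (cop Nat.prime_two hp₃ (by omega))
  refine Nat.squarefree_mul_iff.mpr ⟨h2, Nat.prime_two.squarefree, ?_⟩
  refine Nat.squarefree_mul_iff.mpr ⟨Nat.Coprime.mul_left (cop hp₁ hp₃ h13) (cop hp₂ hp₃ h23), ?_, hp₃.squarefree⟩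
  exact Nat.squarefree_mul_iff.mpr ⟨cop hp₁ hp₂ h12, hp₁.squarefree, hp₂.squarefree⟩

/-- **Every member of `CongruentThetaFamily` is a `ℚ`-model of `E_n` with `n` square-free and EVEN.** [folklore] -/
theorem exists_smul_congruentNumberCurve_even_of_congruentThetaFamily {W : WeierstrassCurve ℚ} [W.IsElliptic]
    [W.IsGloballyMinimal] (h : CongruentThetaFamily W) :
    ∃ n : ℕ, Squarefree n ∧ n % 2 = 0 ∧ ∃ C : VariableChange ℚ, C • congruentNumberCurve n = W := by
  rcases h with ⟨m, q, p, hq, hq4, hp, hp5, hinj, -, -, -, C, hC⟩ |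
      ⟨p₁, p₂, p₃, hp₁, hp₂, hp₃, h₁, h₂, h₃, h12, -, C, hC⟩ |
      ⟨p₁, p₂, p₃, hp₁, hp₂, hp₃, h₁, h₂, h₃, h23, -, -, C, hC⟩ |
      ⟨p₁, p₂, p₃, hp₁, hp₂, hp₃, h₁, h₂, h₃, h23, -, C, hC⟩ |
      ⟨p₁, p₂, p₃, hp₁, hp₂, hp₃, h₁, h₂, h₃, -, C, hC⟩ |
      ⟨p₁, p₂, p₃, hp₁, hp₂, hp₃, h₁, h₂, h₃, -, C, hC⟩
  · exact ⟨_, squarefree_of_thetaTower hq hq4 hp hp5 hinj, by omega, C, hC⟩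
  · exact ⟨_, squarefree_two_mul_three_primes hp₁ hp₂ hp₃ (by omega) (by omega) (by omega) h12 (by omega) (by omega),
      by omega, C, hC⟩
  · exact ⟨_, squarefree_two_mul_three_primes hp₁ hp₂ hp₃ (by omega) (by omega) (by omega) (by omega) (by omega) h23,
      by omega, C, hC⟩
  · exact ⟨_, squarefree_two_mul_three_primes hp₁ hp₂ hp₃ (by omega) (by omega) (by omega) (by omega) (by omega) h23,
      by omega, C, hC⟩
  · exact ⟨_, squarefree_two_mul_three_primes hp₁ hp₂ hp₃ (by omega) (by omega) (by omega) (by omega) (by omega) (by omega),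
      by omega, C, hC⟩
  · exact ⟨_, squarefree_two_mul_three_primes hp₁ hp₂ hp₃ (by omega) (by omega) (by omega) (by omega) (by omega) (by omega),
      by omega, C, hC⟩

/-- Every member of `CongruentThetaFamily` has CM by `ℤ[i]` with `2` ramified (`j = 1728`). [folklore] -/
theorem hasCM_and_cmRamified_two_of_congruentThetaFamily {W : WeierstrassCurve ℚ} [W.IsElliptic]
    [W.IsGloballyMinimal] (h : CongruentThetaFamily W) : W.HasCM ∧ CMRamified W 2 := by
  obtain ⟨n, hsq, -, C, hC⟩ := exists_smul_congruentNumberCurve_even_of_congruentThetaFamily h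
  exact hasCM_and_cmRamified_two_of_smul_congruentNumberCurve hsq.ne_zero hC

/-- **The theta families are disjoint from the proved TYZ families** (even vs. odd square-free parameter). [folklore] -/
theorem not_congruentTYZProvedFamily_of_congruentThetaFamily {W : WeierstrassCurve ℚ} [W.IsElliptic]
    [W.IsGloballyMinimal] (h : CongruentThetaFamily W) : ¬ CongruentTYZProvedFamily W := by
  intro hP
  obtain ⟨n, hsq, hn2, C, hC⟩ := exists_smul_congruentNumberCurve_even_of_congruentThetaFamily h
  obtain ⟨m', hm', hm2, C', hC'⟩ := exists_smul_congruentNumberCurve_odd_of_congruentTYZProvedFamily hP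
  have h := P2.CornerFTwo.Atlas.eq_of_smul_congruentNumberCurve hsq hm' hC hC'
  omega

/-! ### §4. Glue (excluded middle on membership; exactness by §3 and by p544597's `𝒮⁻` disjointness) -/

/-- **Crux 20509's conclusion ⟺ the `𝒮⁻` leaf ∧ the theta leaf ∧ the flag-free residual off both** (EXACT). [folklore] -/
theorem wAllCornerFTwoRamifiedOffTYZProved_iff_sMinus_theta_off :
    WAllCornerFTwoRamifiedOffTYZProved ↔
      WAllCornerFTwoRamifiedSMinus ∧ WAllCornerFTwoRamifiedTheta ∧
        WAllCornerFTwoRamifiedOffTYZProvedOffSMinusOffTheta := by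
  constructor
  · intro h
    exact ⟨wAllCornerFTwoRamifiedSMinus_of_offTYZProved h,
      fun W _ _ hcm hr1 hram hT ↦
        h W hcm hr1 hram (not_congruentTYZProvedFamily_of_congruentThetaFamily hT),
      fun W _ _ hcm hr1 hram hn _ _ ↦ h W hcm hr1 hram hn⟩
  · rintro ⟨hS, hT, hO⟩ W _ _ hcm hr1 hram hn
    by_cases h1 : CongruentMonskySMinusFamily W
    · exact hS W hcm hr1 hram h1
    · by_cases h2 : CongruentThetaFamily W
      · exact hT W hcm hr1 hram h2
      · exact hO W hcm hr1 hram hn h1 h2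

/-- The theta leaf is a restriction of crux 20509's conclusion (by §3) … [folklore] -/
theorem wAllCornerFTwoRamifiedTheta_of_offTYZProved (h : WAllCornerFTwoRamifiedOffTYZProved) :
    WAllCornerFTwoRamifiedTheta :=
  (wAllCornerFTwoRamifiedOffTYZProved_iff_sMinus_theta_off.1 h).2.1

/-- … and the residual off `𝒮⁻` and the theta families is the last restriction. [folklore] -/
theorem wAllCornerFTwoRamifiedOffTYZProvedOffSMinusOffTheta_of_offTYZProved (h : WAllCornerFTwoRamifiedOffTYZProved) :
    WAllCornerFTwoRamifiedOffTYZProvedOffSMinusOffTheta :=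
  (wAllCornerFTwoRamifiedOffTYZProved_iff_sMinus_theta_off.1 h).2.2

/-- **The five-way residual ⟺ its theta part ∧ the six-way residual** (EXACT; pure logic). [folklore] -/
theorem wAllCornerFTwoRamifiedOffTYZOffSMinus_iff_onTheta_off :
    WAllCornerFTwoRamifiedOffTYZOffSMinus ↔
      (∀ (W : WeierstrassCurve ℚ) [W.IsElliptic] [W.IsGloballyMinimal],
          W.HasCM → W.analyticRank = 1 → CMRamified W 2 → ¬ CongruentTYZProvedFamily W →
            ¬ CongruentTYZUPlusFamily W → ¬ CongruentTYZAtlasFJFamily W → ¬ CongruentMonskySMinusFamily W →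
            CongruentThetaFamily W → BSDp W 2) ∧
      WAllCornerFTwoRamifiedOffTYZOffSMinusOffTheta := by
  constructor
  · intro h
    exact ⟨fun W _ _ hcm hr1 hram h1 h2 h3 h4 _ ↦ h W hcm hr1 hram h1 h2 h3 h4,
      fun W _ _ hcm hr1 hram h1 h2 h3 h4 _ ↦ h W hcm hr1 hram h1 h2 h3 h4⟩
  · rintro ⟨hT, hO⟩ W _ _ hcm hr1 hram h1 h2 h3 h4
    by_cases h5 : CongruentThetaFamily W
    · exact hT W hcm hr1 hram h1 h2 h3 h4 h5
    · exact hO W hcm hr1 hram h1 h2 h3 h4 h5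

/-- **The five-way residual from the theta leaf and the six-way residual** — the registered residual stub of crux 20509
(`𝔅_ram ⟹` five-way residual, skeleton 58c6ad09) follows from the theta leaf and the six-way residual. [folklore] -/
theorem wAllCornerFTwoRamifiedOffTYZOffSMinus_of_theta_of_off (hT : WAllCornerFTwoRamifiedTheta)
    (hO : WAllCornerFTwoRamifiedOffTYZOffSMinusOffTheta) : WAllCornerFTwoRamifiedOffTYZOffSMinus :=
  wAllCornerFTwoRamifiedOffTYZOffSMinus_iff_onTheta_off.2
    ⟨fun W _ _ hcm hr1 hram _ _ _ _ h5 ↦ hT W hcm hr1 hram h5, hO⟩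

/-- The six-way residual is a restriction of the five-way one. [folklore] -/
theorem wAllCornerFTwoRamifiedOffTYZOffSMinusOffTheta_of_offSMinus (h : WAllCornerFTwoRamifiedOffTYZOffSMinus) :
    WAllCornerFTwoRamifiedOffTYZOffSMinusOffTheta :=
  (wAllCornerFTwoRamifiedOffTYZOffSMinus_iff_onTheta_off.1 h).2

/-- **The reshaped composition of crux `RamifiedOffTYZOfFacts`' skeleton (five leaves)**: U⁺-road leaf, FJ-atlas leaf,
`𝒮⁻` leaf, theta leaf and the six-way residual give `WAllCornerFTwoRamifiedOffTYZProved` (excluded middle only).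
[folklore] -/
theorem wAllCornerFTwoRamifiedOffTYZProved_of_uPlus_of_atlasFJ_of_sMinus_of_theta_of_off
    (hU : WAllCornerFTwoRamifiedTYZUPlus) (hF : WAllCornerFTwoRamifiedTYZAtlasFJ)
    (hS : WAllCornerFTwoRamifiedSMinus) (hT : WAllCornerFTwoRamifiedTheta)
    (hO : WAllCornerFTwoRamifiedOffTYZOffSMinusOffTheta) : WAllCornerFTwoRamifiedOffTYZProved :=
  wAllCornerFTwoRamifiedOffTYZProved_of_uPlus_of_atlasFJ_of_sMinus_of_offSMinus hU hF hS
    (wAllCornerFTwoRamifiedOffTYZOffSMinus_of_theta_of_off hT hO)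

/-- The theta leaf is a restriction of the ramified slice … [folklore] -/
theorem wAllCornerFTwoRamifiedTheta_of_wAllCornerFTwoRamified (h : WAllCornerFTwoRamified) :
    WAllCornerFTwoRamifiedTheta :=
  fun W _ _ hcm hr1 hram _ ↦ h W hcm hr1 hram

/-- … of row 12₂ … [folklore] -/
theorem wAllCornerFTwoRamifiedTheta_of_wAllCornerFTwo (h : WAllCornerFTwo) : WAllCornerFTwoRamifiedTheta :=
  wAllCornerFTwoRamifiedTheta_of_wAllCornerFTwoRamified (wAllCornerFTwo_iff_slices.1 h).2.2.1

/-- … and of `WAll`. [folklore] -/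
theorem wAllCornerFTwoRamifiedTheta_of_wAll (h : WAll) : WAllCornerFTwoRamifiedTheta :=
  wAllCornerFTwoRamifiedTheta_of_wAllCornerFTwoRamified (cmTwoSlices_of_wAll h).2.2.1

/-- The six-way residual follows from the ramified slice. [folklore] -/
theorem wAllCornerFTwoRamifiedOffTYZOffSMinusOffTheta_of_wAllCornerFTwoRamified (h : WAllCornerFTwoRamified) :
    WAllCornerFTwoRamifiedOffTYZOffSMinusOffTheta :=
  fun W _ _ hcm hr1 hram _ _ _ _ _ ↦ h W hcm hr1 hram

/-- The flag-free residual off `𝒮⁻` and the theta families follows from the ramified slice. [folklore] -/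
theorem wAllCornerFTwoRamifiedOffTYZProvedOffSMinusOffTheta_of_wAllCornerFTwoRamified (h : WAllCornerFTwoRamified) :
    WAllCornerFTwoRamifiedOffTYZProvedOffSMinusOffTheta :=
  fun W _ _ hcm hr1 hram _ _ _ ↦ h W hcm hr1 hram

/-- **The ramified slice ⟺ ON the proved TYZ families ∧ ON `𝒮⁻` ∧ ON the theta families ∧ OFF all three** (EXACT).
[folklore] -/
theorem wAllCornerFTwoRamified_iff_tyzProved_sMinus_theta_off :
    WAllCornerFTwoRamified ↔ WAllCornerFTwoRamifiedTYZProved ∧ WAllCornerFTwoRamifiedSMinus ∧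
      WAllCornerFTwoRamifiedTheta ∧ WAllCornerFTwoRamifiedOffTYZProvedOffSMinusOffTheta := by
  rw [wAllCornerFTwoRamified_iff_tyzProved_offTYZProved, wAllCornerFTwoRamifiedOffTYZProved_iff_sMinus_theta_off]

/-- **Row 12₂ with the proved TYZ families, `𝒮⁻` and the theta families carved out**: `WAllCornerFTwo` ⟺ split-good ∧
split-bad ∧ (TYZProved ∧ SMinus ∧ Theta ∧ residual) ∧ inert-good ∧ inert-bad. [folklore] -/
theorem wAllCornerFTwo_iff_slices_tyzProved_sMinus_theta :
    WAllCornerFTwo ↔ WAllCornerFTwoSplitGood ∧ WAllCornerFTwoSplitBad ∧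
      (WAllCornerFTwoRamifiedTYZProved ∧ WAllCornerFTwoRamifiedSMinus ∧ WAllCornerFTwoRamifiedTheta ∧
        WAllCornerFTwoRamifiedOffTYZProvedOffSMinusOffTheta) ∧
      WAllCornerFTwoInertGood ∧ WAllCornerFTwoInertBad := by
  rw [wAllCornerFTwo_iff_slices_tyzProved, wAllCornerFTwoRamifiedOffTYZProved_iff_sMinus_theta_off]

end Summit.BirchSwinnertonDyer

end
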